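import Summits.CriticalPhenomena.PercolationContinuityZ3.Theses.PercTwoPointDecay
import Summits.CriticalPhenomena.PercolationContinuityZ3.Theses.PercShatteringRace
import HarnessLib

/-!
# Crux workfile — `CritBallAverageDecay` (stmt-CriticalPhenomena-0833): the weaker transfer `BulkLeFreeBallSum`

Crux-strategist record (unit `cstrat-stmt-CriticalPhenomena-0833-r1`).  The "box-to-bulk passage"

  `BulkLeFreeBallSum`: `∃ k ≥ 1, C, ∀ R ≥ 1, Σ_{x ∈ Λ_R} τ_{p_c}(0,x) ≤ C · Σ_{y ∈ Λ_{kR}} P_{p_c}(0 ↔ y inside Λ_{kR})`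

is the weakest natural second piece of X_A next to the in-box rate S(1/2) (Hutchcroft 2022, arXiv:2202.07634
p. 5).  It follows from `PercHyperscalingGluing.BoxGluing` and the BK escape bound
`τ(0,x) ≤ P(0 ↔ x inside Λ_{2R}) + π_R²` (`x ∈ Λ_R`), so it is NOT filed as a separate item (it would be
`BoxGluing`-lite); the split filed on the ledger uses `BoxGluing` itself
(`Theorems/PercTwoPointDecayCritBallAverageDecaySplit.lean`).  This file types the statement and certifies the
three-line glue `S(1/2) ∧ BulkLeFreeBallSum ⟹ X_A` (a = 1/2).  Sorry-free.
-/

noncomputable section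

namespace Summit.CriticalPhenomena.PercolationContinuityZ3.Cruxes.CritBallAverageDecay

open MeasureTheory Finset
open Literature.Probability.Percolation Literature.Probability.LatticeModels
open Summit.CriticalPhenomena.PercolationContinuityZ3.Theses.PercTwoPointDecay (CritBallAverageDecay)
open Summit.CriticalPhenomena.PercolationContinuityZ3.Theses.PercShatteringRace (FreeSusceptibilityPowerSaving)

/-- **Box-to-bulk passage at `p_c(ℤ³)`** (candidate piece, typed; not an item): the bulk ball sum of the
critical two-point function is dominated, up to a constant, by the free (in-box) ball sum at a fixed larger
scale. Jump-compatible (a monolithic jump world satisfies it); in the orthodox critical picture both sides are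
`≍ R^{2-η}`. [folklore] -/
def BulkLeFreeBallSum : Prop :=
  ∃ (k : ℕ) (C : ℝ), 1 ≤ k ∧ ∀ R : ℕ, 1 ≤ R → ∑ x ∈ Literature.Probability.LatticeModels.box 3 R, (Literature.Probability.Percolation.bondPercolation (Literature.Probability.LatticeModels.zdGraph 3) (Literature.Probability.Percolation.criticalProbI 3)).real (Literature.Probability.Percolation.openConn 0 x) ≤ C * ∑ y ∈ Literature.Probability.LatticeModels.box 3 (k * R), (Literature.Probability.Percolation.bondPercolation (Literature.Probability.LatticeModels.zdGraph 3) (Literature.Probability.Percolation.criticalProbI 3)).real (Literature.Probability.Percolation.openConnIn ↑(Literature.Probability.LatticeModels.box 3 (k * R)) 0 y)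

/-- **The weaker sufficient transfer ("box-to-bulk passage"), recorded with its glue**: if the bulk ball sum
is dominated by the free ball sum at a fixed larger scale,
`∃ k ≥ 1, C, ∀ R ≥ 1, Σ_{x ∈ Λ_R} τ_{p_c}(0,x) ≤ C · Σ_{y ∈ Λ_{kR}} P_{p_c}(0 ↔ y inside Λ_{kR})`,
then S(1/2) gives X_A with `a = 1/2` and constant `|C| · |C'| · k^{5/2}` (three lines: the free sum is
`≥ 0` and `≤ C'(kR)^{5/2} = C' k^{5/2} R^{3-1/2}`).  This hypothesis follows from `BoxGluing` plus the BK escape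
bound `τ(0,x) ≤ τ^{Λ_{2R}}(0,x) + π_R²` (`x ∈ Λ_R`); it names Hutchcroft's missing passage from in-box to
full-space two-point estimates (arXiv:2202.07634, p. 5) and is deliberately NOT filed as an item. [folklore] -/
theorem critBallAverageDecay_of_freeSusceptibility_of_bulkLeFree (hS : FreeSusceptibilityPowerSaving)
    (hG : BulkLeFreeBallSum) : CritBallAverageDecay := by
  obtain ⟨C, hC⟩ := hS
  obtain ⟨k, C', hk, hG⟩ := hG
  refine ⟨1 / 2, |C'| * (|C| * (k : ℝ) ^ ((5 : ℝ) / 2)), by norm_num, fun R hR => ?_⟩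
  have hkR : 1 ≤ k * R := by
    calc 1 = 1 * 1 := by ring
      _ ≤ k * R := Nat.mul_le_mul hk hR
  set F : ℝ := ∑ y ∈ box 3 (k * R), (bondPercolation (zdGraph 3) (criticalProbI 3)).real
      (openConnIn (↑(box 3 (k * R)) : Set (Site 3)) 0 y) with hF
  have hF0 : 0 ≤ F := Finset.sum_nonneg fun _ _ => measureReal_nonneg
  have hrpow0 : 0 ≤ (((k * R : ℕ) : ℝ)) ^ ((5 : ℝ) / 2) := Real.rpow_nonneg (by positivity) _
  have h52 : (3 : ℝ) - 1 / 2 = 5 / 2 := by norm_num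
  have hsplit : (((k * R : ℕ) : ℝ)) ^ ((5 : ℝ) / 2) =
      (k : ℝ) ^ ((5 : ℝ) / 2) * (R : ℝ) ^ ((5 : ℝ) / 2) := by
    push_cast
    exact Real.mul_rpow (by positivity) (by positivity)
  calc ∑ x ∈ box 3 R, (bondPercolation (zdGraph 3) (criticalProbI 3)).real (openConn 0 x)
      ≤ C' * F := hG R hR
    _ ≤ |C'| * F := mul_le_mul_of_nonneg_right (le_abs_self C') hF0
    _ ≤ |C'| * (C * (((k * R : ℕ) : ℝ)) ^ ((5 : ℝ) / 2)) :=
        mul_le_mul_of_nonneg_left (hC (k * R) hkR) (abs_nonneg _)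
    _ ≤ |C'| * (|C| * (((k * R : ℕ) : ℝ)) ^ ((5 : ℝ) / 2)) :=
        mul_le_mul_of_nonneg_left (mul_le_mul_of_nonneg_right (le_abs_self C) hrpow0) (abs_nonneg _)
    _ = |C'| * (|C| * (k : ℝ) ^ ((5 : ℝ) / 2)) * (R : ℝ) ^ (3 - 1 / 2 : ℝ) := by
        rw [h52, hsplit]; ring


end Summit.CriticalPhenomena.PercolationContinuityZ3.Cruxes.CritBallAverageDecay
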